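import Mathlib
import HarnessLib
import Literature.Probability.MarkovChains.RelaxationTimeVarianceDecay
import Literature.Probability.MarkovChains.InitialSequence
import Literature.Probability.MarkovChains.CountingBound

/-!
# `ℝ` has Markov type 2 with constant 1: `E_π[(f(Z_t) − f(Z_0))²] ≤ t · E_π[(f(Z_1) − f(Z_0))²]` for reversible chains (Lyons–Peres Theorem 13.13, Ball 1992)

HONEST FRAMING: exact (Metropolis-corrected) sampling algorithms for lattice gauge theory; figures
of merit are autocorrelation/cost numbers at stated couplings and volumes; no continuum-physics claim.

Source: R. Lyons, Y. Peres, *Probability on Trees and Networks*, Cambridge University Press 2016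
[LyonsPeres2016], §13.4 "Markov Type of Metric Spaces": DEFINITION 13.12 (Markov type 2 with
constant `M`: `E[d(f(Z_t), f(Z_0))²] ≤ M t E[d(f(Z_1), f(Z_0))²]` for every stationary reversible
chain on a finite set, every `f` and every `t`, eq. (13.20)), THEOREM 13.13 ("`ℝ` has Markov type 2
with constant `M = 1`"; the result is due to Ball (1992)) and its proof: eq. (13.21)
`E d(f(Z_t), f(Z_0))² = Σ_{i,j} π_i p^{(t)}_{ij} [f(i) − f(j)]² = 2((I − Pᵗ)f, f)_π`, the reduction to
`(1 − λᵗ) ≤ t(1 − λ)` for an eigenfunction ("`1 + λ + ⋯ + λ^{t−1} ≤ t`, which is obviously true"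
since all eigenvalues lie in `[−1,1]`), and the expansion `f = Σ_j a_j f_j` in an orthonormal basis
of eigenfunctions.

Conventions of this directory: finite `X`, row-stochastic `P : Matrix X X ℝ` reversible with respect
to a positive weight `π` (`DetailedBalance π P`), `kernelAt P t x y = Pᵗ(x,y)`
(`MixingTimeSubmultiplicative.lean`), `piInner π g h = ⟨g,h⟩_π` and
`dirichletForm π Q u = ½ Σ_x Σ_y π(x)Q(x,y)(u(x) − u(y))²` (`PeskunOrdering.lean`), the
`π`-orthonormal eigenbasis `specFun hA j = f_j`, `specVal hA j = λ_j` (`SpectralRepresentation.lean`,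
Levin–Peres–Wilmer Lemma 12.2) with eq. (12.5) `Pᵗf = Σ_j ⟨f,f_j⟩_π λ_jᵗ f_j`
(`RelaxationTimeVarianceDecay.lean`).  The stationary chain `(Z_s)` enters only through its
two-dimensional marginals `P[Z_0 = x, Z_t = y] = π(x)Pᵗ(x,y)`, so `E[(f(Z_t) − f(Z_0))²]` is WRITTEN
as the finite sum `Σ_x Σ_y π(x) Pᵗ(x,y) (f(x) − f(y))²` (eq. (13.21), first equality).

Main results (all PROVED; 0 named facts, 0 definitions):
* `LyonsPeres2016_eq_13_21` — **(13.21)**: `Σ_x Σ_y π(x)Pᵗ(x,y)(f(x) − f(y))² = 2⟨(I − Pᵗ)f, f⟩_π`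
  [cite: LyonsPeres2016, §13.4 eq. (13.21)];
* `piInner_kernelAt_mulVec_eq_sum` — `⟨f, Pᵗf⟩_π = Σ_j ⟨f,f_j⟩²_π λ_jᵗ` and
  `dirichletForm_kernelAt_eq_sum` — `⟨(I − Pᵗ)f, f⟩_π = Σ_j ⟨f,f_j⟩²_π (1 − λ_jᵗ)`
  [cite: LyonsPeres2016, §13.4, proof of Thm 13.13];
* `one_sub_pow_le_mul_one_sub` — `1 − λᵗ ≤ t(1 − λ)` for `|λ| ≤ 1`
  [cite: LyonsPeres2016, §13.4, proof of Thm 13.13];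
* `LyonsPeres2016_thm_13_13_dirichletForm` — `⟨(I − Pᵗ)f, f⟩_π ≤ t⟨(I − P)f, f⟩_π`, and
  **THEOREM 13.13** `LyonsPeres2016_thm_13_13` —
  **`Σ_x Σ_y π(x)Pᵗ(x,y)(f(x) − f(y))² ≤ t · Σ_x Σ_y π(x)P(x,y)(f(x) − f(y))²`** for every
  row-stochastic `P` reversible with respect to `π > 0`, every `f : X → ℝ` and every `t`
  [cite: LyonsPeres2016, §13.4 Thm 13.13].
NOT CLAIMED: general metric spaces / Hilbert space (Definition 13.12 in full generality), Theorem
13.14 (trees), Lemma 13.15 (the maximal version), infinite state spaces.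

Context (cell pub-lqcd): for ANY real observable `f` (e.g. a topological charge) of a stationary
reversible sampler, the mean-square displacement after `t` steps is at most `t` times the one-step
mean-square displacement — reversible chains move observables at most diffusively; a sampler whose
single step changes `f` by `O(1)` in mean square needs `t ≳ Var_π(f)`-many steps to decorrelate `f`.
-/

namespace Literature.Probability.MarkovChains

open Finset Matrix

variable {X : Type*} [Fintype X] [DecidableEq X]
variable {π : X → ℝ} {P : Matrix X X ℝ}

/-- `P¹(x,y) = P(x,y)`. [cite: LevinPeres2017, §1.1 (`Pᵗ`, `t = 1`)] -/
private theorem kernelAt_one_apply (P : Matrix X X ℝ) (x y : X) : kernelAt P 1 x y = P x y := by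
  rw [kernelAt_succ_apply, Finset.sum_eq_single x (fun z _ hz => by
    rw [kernelAt_zero_apply, if_neg hz, zero_mul]) (fun h => absurd (mem_univ x) h),
    kernelAt_zero_apply, if_pos rfl, one_mul]

/-- `π` is stationary for `Pᵗ` when it is for `P`. [cite: LevinPeres2017, §1.5 eq. (1.22)
(`π = πP`, iterated)] -/
theorem isStationary_kernelAt {P : X → X → ℝ} (hst : IsStationary π P) (t : ℕ) :
    IsStationary π (kernelAt P t) := fun y => by
  have h := congr_fun (stepLaw_kernelAt_eq_self_of_isStationary hst t) y
  unfold stepLaw at h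
  exact h

/-- **(13.21)**: `E d(f(Z_t), f(Z_0))² = Σ_x Σ_y π(x)Pᵗ(x,y)(f(x) − f(y))² = 2((I − Pᵗ)f, f)_π`,
the right-hand side written `2(⟨f,f⟩_π − ⟨f,Pᵗf⟩_π)` ("note that `Pᵗ` is also reversible with
respect to `π`"; only `πPᵗ = π` is used). [cite: LyonsPeres2016, §13.4 eq. (13.21)] -/
theorem LyonsPeres2016_eq_13_21 (hP : IsRowStochastic P) (hst : IsStationary π P) (f : X → ℝ)
    (t : ℕ) :
    ∑ x, ∑ y, π x * kernelAt P t x y * (f x - f y) ^ 2 =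
      2 * (piInner π f f - piInner π f (kernelAt P t *ᵥ f)) := by
  have h := dirichletForm_eq (π := π) (P := kernelAt P t) (kernelAt_isRowStochastic hP t)
    (isStationary_kernelAt hst t) f
  unfold dirichletForm at h
  linarith

/-- **`⟨f, Pᵗf⟩_π = Σ_j a_j² λ_jᵗ`** with `a_j = ⟨f,f_j⟩_π` (eq. (12.5) paired with `f`).
[cite: LyonsPeres2016, §13.4, proof of Thm 13.13 ("taking `f = Σ_j a_j f_j`")];
[cite: LevinPeres2017, §12.1 eq. (12.5)] -/
theorem piInner_kernelAt_mulVec_eq_sum (hπ : ∀ x, 0 < π x) (hA : (symmMatrix π P).IsHermitian)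
    (f : X → ℝ) (t : ℕ) :
    piInner π f (kernelAt P t *ᵥ f) = ∑ j, piInner π f (specFun hA j) ^ 2 * specVal hA j ^ t := by
  set a : X → ℝ := fun j => piInner π f (specFun hA j) with ha
  have h1 : (kernelAt P t *ᵥ f) = fun x => ∑ j, a j * specVal hA j ^ t * specFun hA j x := by
    funext x
    rw [← LevinPeres2017_eq_12_5 hπ hA f t x]
    rfl
  have hlin : ∀ (j : X) (c : ℝ), ∑ x, π x * (f x * (c * specFun hA j x)) = c * a j := by
    intro j c
    show _ = c * piInner π f (specFun hA j)
    unfold piInner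
    rw [mul_sum]
    exact sum_congr rfl fun x _ => by ring
  show ∑ x, π x * (f x * (kernelAt P t *ᵥ f) x) = _
  rw [h1]
  simp only [mul_sum]
  rw [sum_comm]
  refine sum_congr rfl fun j _ => ?_
  rw [hlin j (a j * specVal hA j ^ t)]
  ring

/-- **`⟨(I − Pᵗ)f, f⟩_π = Σ_j a_j² (1 − λ_jᵗ)`** (`t = 0` of the previous identity is Parseval
`⟨f,f⟩_π = Σ_j a_j²`). [cite: LyonsPeres2016, §13.4, proof of Thm 13.13] -/
theorem dirichletForm_kernelAt_eq_sum (hπ : ∀ x, 0 < π x) (hA : (symmMatrix π P).IsHermitian)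
    (f : X → ℝ) (t : ℕ) :
    piInner π f f - piInner π f (kernelAt P t *ᵥ f) =
      ∑ j, piInner π f (specFun hA j) ^ 2 * (1 - specVal hA j ^ t) := by
  have h0 := piInner_kernelAt_mulVec_eq_sum hπ hA f 0
  have hid : kernelAt P 0 *ᵥ f = f := by
    funext x
    show ∑ y, kernelAt P 0 x y * f y = f x
    rw [Finset.sum_eq_single x (fun z _ hz => by rw [kernelAt_zero_apply, if_neg hz, zero_mul])
      (fun h => absurd (mem_univ x) h), kernelAt_zero_apply, if_pos rfl, one_mul]
  rw [hid] at h0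
  simp_rw [pow_zero, mul_one] at h0
  rw [h0, piInner_kernelAt_mulVec_eq_sum hπ hA f t, ← sum_sub_distrib]
  exact sum_congr rfl fun j _ => by ring

/-- **`1 − λᵗ ≤ t(1 − λ)` for `|λ| ≤ 1`** ("this in turn reduces to `1 + λ + ⋯ + λ^{t−1} ≤ t`, which
is obviously true"). [cite: LyonsPeres2016, §13.4, proof of Thm 13.13] -/
theorem one_sub_pow_le_mul_one_sub {lam : ℝ} (h : |lam| ≤ 1) (t : ℕ) :
    1 - lam ^ t ≤ t * (1 - lam) := by
  obtain ⟨h1, h2⟩ := abs_le.mp h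
  have hgeom : 1 - lam ^ t = (1 - lam) * ∑ i ∈ range t, lam ^ i := by
    have := geom_sum_mul_neg lam t
    linarith [this]
  have hsum : ∑ i ∈ range t, lam ^ i ≤ t := by
    calc ∑ i ∈ range t, lam ^ i ≤ ∑ _i ∈ range t, (1 : ℝ) :=
          sum_le_sum fun i _ => (le_abs_self _).trans (by rw [abs_pow]; exact pow_le_one₀ (abs_nonneg _) h)
      _ = t := by rw [sum_const, card_range, nsmul_eq_mul, mul_one]
  rw [hgeom, mul_comm]
  exact mul_le_mul_of_nonneg_right hsum (by linarith)

/-- **THEOREM 13.13, operator form: `((I − Pᵗ)f, f)_π ≤ t((I − P)f, f)_π`** for a row-stochastic `P`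
reversible with respect to `π > 0`. [cite: LyonsPeres2016, §13.4 Thm 13.13 (proof)] -/
theorem LyonsPeres2016_thm_13_13_dirichletForm (hπ : ∀ x, 0 < π x) (hP : IsRowStochastic P)
    (hDB : DetailedBalance π P) (f : X → ℝ) (t : ℕ) :
    piInner π f f - piInner π f (kernelAt P t *ᵥ f) ≤
      t * (piInner π f f - piInner π f (P *ᵥ f)) := by
  have hA : (symmMatrix π P).IsHermitian := symmMatrix_isHermitian hπ hDB
  have h1 : piInner π f f - piInner π f (P *ᵥ f) =
      ∑ j, piInner π f (specFun hA j) ^ 2 * (1 - specVal hA j ^ 1) := by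
    rw [← dirichletForm_kernelAt_eq_sum hπ hA f 1]
    congr 2
    funext x
    show ∑ y, P x y * f y = ∑ y, kernelAt P 1 x y * f y
    simp_rw [kernelAt_one_apply]
  rw [dirichletForm_kernelAt_eq_sum hπ hA f t, h1, mul_sum]
  refine sum_le_sum fun j _ => ?_
  rw [pow_one, mul_left_comm]
  exact mul_le_mul_of_nonneg_left (one_sub_pow_le_mul_one_sub (abs_specVal_le_one' hπ hP hA j) t)
    (sq_nonneg _)

/-- **THEOREM 13.13 (`ℝ` has Markov type 2 with constant `M = 1`; Ball 1992).** For every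
row-stochastic `P` reversible with respect to a positive weight `π`, every `f : X → ℝ` and every `t`:
`E[(f(Z_t) − f(Z_0))²] ≤ t · E[(f(Z_1) − f(Z_0))²]` for the stationary chain, i.e.
`Σ_x Σ_y π(x)Pᵗ(x,y)(f(x) − f(y))² ≤ t · Σ_x Σ_y π(x)P(x,y)(f(x) − f(y))²`.
[cite: LyonsPeres2016, §13.4 Thm 13.13, Definition 13.12 eq. (13.20)] -/
theorem LyonsPeres2016_thm_13_13 (hπ : ∀ x, 0 < π x) (hP : IsRowStochastic P)
    (hDB : DetailedBalance π P) (f : X → ℝ) (t : ℕ) :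
    ∑ x, ∑ y, π x * kernelAt P t x y * (f x - f y) ^ 2 ≤
      t * ∑ x, ∑ y, π x * P x y * (f x - f y) ^ 2 := by
  have hst : IsStationary π P := hDB.isStationary hP.2
  rw [LyonsPeres2016_eq_13_21 hP hst f t]
  have h1 : ∑ x, ∑ y, π x * P x y * (f x - f y) ^ 2 =
      2 * (piInner π f f - piInner π f (P *ᵥ f)) := by
    have h := dirichletForm_eq hP hst f
    unfold dirichletForm at h
    linarith
  rw [h1]
  have h2 := LyonsPeres2016_thm_13_13_dirichletForm hπ hP hDB f t
  nlinarith [h2, Nat.cast_nonneg (α := ℝ) t]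

/-- The same in the `dirichletForm` notation of `PeskunOrdering.lean`:
`𝓔_{Pᵗ}(f) ≤ t · 𝓔_P(f)`. [cite: LyonsPeres2016, §13.4 Thm 13.13] -/
theorem LyonsPeres2016_thm_13_13' (hπ : ∀ x, 0 < π x) (hP : IsRowStochastic P)
    (hDB : DetailedBalance π P) (f : X → ℝ) (t : ℕ) :
    dirichletForm π (kernelAt P t) f ≤ t * dirichletForm π P f := by
  unfold dirichletForm
  have h := LyonsPeres2016_thm_13_13 hπ hP hDB f t
  nlinarith [h, Nat.cast_nonneg (α := ℝ) t]

end Literature.Probability.MarkovChains
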